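import Literature.MathematicalPhysics.QuantumFieldTheory.Balaban1983to89.B12EdgeTreeLength257L1
import Literature.MathematicalPhysics.QuantumFieldTheory.Balaban1983to89.B12ShortestEdgeTree257

/-!
# `Balaban1983to89.B12ShortestTreeGraph257` — [Balaban1987RG1] p. 257, «Consider a class of TREE graphs contained in X
and intersecting all the cubes in X. A length of a shortest graph in this class … is the linear size of X»: the
linear size `TreeLength.treeLen X` (defined over connected finite unions of segments, convention (ii) of
`TreeLength`) IS ATTAINED BY A TREE GRAPH — a properly embedded polygonal graph whose endpoint graph is a tree
(proved: simplest shortest graphs are simple; subdivision at anchors; spanning-tree extraction)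

statement-level skeleton of published theorems with citation tags; proofs where landed; nothing here is a claim about
the Yang–Mills mass gap

CITATION HEADER (lean-in-tree rule 2026-08-18).  Source under audit: T. Bałaban, *Renormalization group approach to
lattice gauge field theories. I.*, Commun. Math. Phys. **109**, 249–301 (1987) [Balaban1987RG1] (cell paper B12 = "[I]";
held `paper:balaban1987-cmp109-rg-i-small-field`, journal page = PDF page + 248; p. 257 = PDF p. 9).  Satellite of
`…Balaban1983to89.TreeLength` (whose header, convention (ii), reads: the infimum is taken over connected finite unions
of segments meeting every cube, *"a tree graph is such a union; conversely …"* — the pruning to tree graphs was not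
formalised), of `…B12ShortestGraph257` (attainment of `treeLen`: `exists_admissible_len_eq_treeLen`; paths
`pathSegs`; `reflTransGen_of_isPreconnected_iUnion`) and of `…B12EdgeTreeLength257L1` (anchors `meetPt`/`cubePt`/
`anchors`, parameters `paramOf`); nothing existing is modified.  Cell records: ROWS-B12 (r09) row B12.Note@257;
`TreeLength` convention (ii).  Unit `lit-balaban-r09` gen 15 (reader/typer r09, display owner of B12).

WHAT IS FORMALISED HERE (kernel-checked).
* §1 — SIMPLEST SHORTEST GRAPHS `MinShortest X T`: admissible, of length treeLen X, with the least number of members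
  among such; they exist whenever an admissible graph exists (`exists_minShortest`, from the attainment theorem and
  well-ordering of ℕ).
* §2–§3 — erasing a member (`len_erase`, `carrier_eq_union_erase`); a simplest shortest graph with ≥ 2 members has NO
  DEGENERATE member (`MinShortest.nondegenerate`: a point member on the rest is superfluous, off the rest it
  disconnects the carrier).
* §4–§5 — COLLINEAR MERGING: a segment containing two distinct points p ≠ q lies on the line through them
  (`exists_params_of_two_mem`); two distinct members with two common points merge into the hull segment on that line
  (same carrier, not longer, one member less: `exists_merge`); hence in a simplest shortest graph TWO DISTINCT MEMBERS
  MEET IN AT MOST ONE POINT (`MinShortest.subsingleton_inter`) and no member is listed in both orientations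
  (`MinShortest.swap_not_mem`); summary `exists_simple_shortest_graph`.
* §6 — PROPERLY EMBEDDED polygonal graphs (`ProperlyEmbedded`: two members are the same segment up to orientation, or
  their common points are endpoints of both), the ENDPOINT GRAPH `egraph T` (Mathlib `SimpleGraph.fromRel` on the
  endpoint set `vertsR T`), TREE GRAPHS (`IsTreeGraph T := ProperlyEmbedded T ∧ (egraph T).IsTree`);
  `egraph_connected` (connected carrier ⇒ connected endpoint graph, closed-set separation),
  `card_edgeSet_egraph_le`, `isTreeGraph_singleton`.
* §7 — SPANNING-TREE EXTRACTION `exists_treeGraph_sub`: a properly embedded admissible graph with non-degenerate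
  members and a vertex in every cube of X contains an admissible tree graph, not longer (Mathlib
  `SimpleGraph.Connected.exists_isTree_le`, `IsTree.card_edgeFinset`, `isTree_iff_connected_and_card`; connectedness
  of the carrier by walk induction; Mathlib `IsConnected.iUnion_of_reflTransGen`).
* §8 — SUBDIVISION AT ANCHORS `subdivAll` / `subdivAll_spec`: cutting every member of a graph as in §5 at all
  endpoints and anchors (one common point per pair of meeting members, one point per cube) lying on it yields a
  PROPERLY EMBEDDED admissible graph with non-degenerate members, not longer, with a vertex in every cube (two
  sub-segments of one member meet only at a common cut point by injectivity of the parametrisation; sub-segments of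
  distinct members meet only at THE common point of the members, which is an anchor, hence a cut point of both).
* §9 — MAIN: `exists_shortest_treeGraph` (∃ T admissible, IsTreeGraph T, len T = treeLen X, whenever X carries an
  admissible graph), `treeLen_eq_sInf_treeGraphs` (the infimum over tree graphs equals treeLen X — convention (ii) is
  immaterial), `exists_shortest_treeGraph_of_faceConnected` (localization domains).
* §10 (revision v1.1, append-only; import `B12ShortestEdgeTree257` added) — THE PRINTED SENTENCES WITH EVERY WORD
  LITERAL: `exists_shortest_edgeTree_len1` (ℓ¹ reading: an admissible EDGE graph whose combinatorial graph is a TREE and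
  which is ℓ¹-shortest among ALL admissible graphs — «there are also the shortest tree graphs formed by edges of
  cubes»), `shortest_trees_compare` (sup metric of record: a shortest continuum tree graph and a shortest edge tree
  exist, treeLen X ≤ edgeLen X ≤ d · treeLen X).
* §11 (revision v1.2, append-only) — THE STEINER LENGTH («the length of a minimal tree intersecting every cube in X»,
  [Dimock2013BalabanII] App. E, the wording behind `TreeLength.steinerLen`): `exists_shortest_steiner_treeGraph`
  (steinerLen Y is attained by a Steiner-admissible TREE GRAPH, every non-empty Y: a Steiner-shortest graph T₀ —
  `B12ShortestGraph257.exists_sAdmissible_len_eq_steinerLen` — is admissible for the finite set X ⊇ Y of the unit cubes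
  it meets, treeLen X = steinerLen Y, and §9 applies), `steinerLen_eq_sInf_treeGraphs`.

HONEST SCOPE.  (a) «Tree graph» is formalised as: properly embedded (no crossings, T-junctions or overlaps between
members) with the combinatorial endpoint graph a tree (Mathlib `SimpleGraph.IsTree`); that the carrier of such a
graph is then a topological tree (dendrite) is not formalised and not needed for the sentence.  (b) The length is the
sup-metric length of record (`TreeLength.len`); the argument uses only additivity of length along a line and would
apply verbatim to any norm (not formalised for other norms).  (c) Route ours; the print gives none («it is easy to
see»-level material).  Value = kernel-checked closure of a convention of the typed skeleton, NOT summit progress.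
-/

namespace Literature.MathematicalPhysics.QuantumFieldTheory.Balaban1983to89.B12ShortestTreeGraph257

noncomputable section

open Literature.MathematicalPhysics.QuantumFieldTheory.Balaban1983to89
open Literature.MathematicalPhysics.QuantumFieldTheory.Balaban1983to89.B13ScaleTransfer
open Literature.MathematicalPhysics.QuantumFieldTheory.Balaban1983to89.TreeLength
open Literature.MathematicalPhysics.QuantumFieldTheory.Balaban1983to89.B12ShortestGraph257
open Literature.MathematicalPhysics.QuantumFieldTheory.Balaban1983to89.B12EdgeTreeLength257
open Literature.MathematicalPhysics.QuantumFieldTheory.Balaban1983to89.B12EdgeTreeLength257L1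
open Literature.MathematicalPhysics.QuantumFieldTheory.Balaban1983to89.B12ShortestEdgeTree257
open _root_.Topology Relation

variable {d : ℕ}

/-! ## §1. Shortest graphs with the fewest segments -/

/-- A SIMPLEST SHORTEST GRAPH: an admissible graph of length `treeLen X` with the least number of segments among all
admissible graphs of that length. [cite: Balaban1987RG1, p.257 (linear size d_j, a shortest graph)] -/
structure MinShortest (X : Finset (Pt d)) (T : List (Seg d)) : Prop where
  /-- admissible -/
  adm : Admissible X T
  /-- shortest -/
  len_eq : len T = treeLen X
  /-- fewest segments among the shortest graphs -/
  minimal : ∀ T', Admissible X T' → len T' = treeLen X → T.length ≤ T'.length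

/-- A SIMPLEST SHORTEST GRAPH EXISTS whenever an admissible graph exists (`B12ShortestGraph257.exists_admissible_len_eq_treeLen`
and well-ordering of ℕ). [cite: Balaban1987RG1, p.257 (linear size d_j, a shortest graph)] -/
theorem exists_minShortest {X : Finset (Pt d)} (hne : ∃ T, Admissible X T) : ∃ T, MinShortest X T := by
  classical
  have hex : ∃ n, ∃ T, Admissible X T ∧ len T = treeLen X ∧ T.length = n := by
    obtain ⟨T, hT, hlen⟩ := exists_admissible_len_eq_treeLen hne
    exact ⟨T.length, T, hT, hlen, rfl⟩
  obtain ⟨T, hT, hlen, hn⟩ := Nat.find_spec hex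
  refine ⟨T, ⟨hT, hlen, fun T' hT' hlen' => ?_⟩⟩
  rw [hn]
  exact Nat.find_min' hex ⟨T', hT', hlen', rfl⟩

/-- A graph not longer than a simplest shortest graph and admissible is itself shortest; hence it has at least as
many segments. [cite: Balaban1987RG1, p.257 (linear size d_j, a shortest graph)] -/
theorem MinShortest.length_le {X : Finset (Pt d)} {T T' : List (Seg d)} (h : MinShortest X T) (hT' : Admissible X T')
    (hle : len T' ≤ len T) : T.length ≤ T'.length :=
  h.minimal T' hT' (le_antisymm (h.len_eq ▸ hle) (treeLen_le_len hT'))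

/-! ## §2. List plumbing: erasing a member -/

/-- Length and sup-length after erasing a member. [cite: Balaban1987RG1, p.257 (linear size d_j, a shortest graph)] -/
theorem len_erase {T : List (Seg d)} {σ : Seg d} (hσ : σ ∈ T) :
    len T = dist σ.1 σ.2 + len (T.erase σ) ∧ T.length = (T.erase σ).length + 1 := by
  have hp := List.perm_cons_erase hσ
  constructor
  · rw [len_eq_sum_map, len_eq_sum_map (T.erase σ), (hp.map _).sum_eq, List.map_cons, List.sum_cons]
  · rw [hp.length_eq, List.length_cons]

/-- The carrier of a graph is the segment of a member together with the carrier of the rest. [cite: Balaban1987RG1, p.257 (linear size d_j, a shortest graph)] -/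
theorem carrier_eq_union_erase {T : List (Seg d)} {σ : Seg d} (hσ : σ ∈ T) :
    carrier T = segment ℝ σ.1 σ.2 ∪ carrier (T.erase σ) := by
  ext z
  rw [mem_carrier, Set.mem_union, mem_carrier]
  constructor
  · rintro ⟨s, hs, hz⟩
    by_cases hsσ : s = σ
    · subst hsσ; exact Or.inl hz
    · exact Or.inr ⟨s, (List.mem_erase_of_ne hsσ).2 hs, hz⟩
  · rintro (hz | ⟨s, hs, hz⟩)
    · exact ⟨σ, hσ, hz⟩
    · exact ⟨s, List.erase_subset hs, hz⟩

/-! ## §3. A simplest shortest graph has no degenerate segment (unless it is a single point) -/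

/-- In a simplest shortest graph with at least two members every member is a NON-DEGENERATE segment: a degenerate
member [p, p] either lies on the rest of the graph (then it is superfluous) or is separated from it (contradicting
connectedness). [cite: Balaban1987RG1, p.257 (linear size d_j, a shortest graph)] -/
theorem MinShortest.nondegenerate {X : Finset (Pt d)} {T : List (Seg d)} (h : MinShortest X T) (h2 : 2 ≤ T.length)
    {σ : Seg d} (hσ : σ ∈ T) : σ.1 ≠ σ.2 := by
  intro heq
  have hlen := len_erase hσ
  set T' := T.erase σ with hT'
  -- the rest is non-empty
  have hT'ne : T' ≠ [] := by
    intro h0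
    rw [h0, List.length_nil] at hlen
    omega
  by_cases hp : σ.1 ∈ carrier T'
  · -- superfluous member
    have hc : carrier T' = carrier T := by
      rw [carrier_eq_union_erase hσ, ← heq, segment_same, Set.union_eq_right.2 (Set.singleton_subset_iff.2 hp)]
    have hle : T.length ≤ T'.length :=
      h.length_le (⟨hc ▸ h.adm.connected, hc ▸ h.adm.subset, fun x hx => hc ▸ h.adm.meets x hx⟩ :
        Admissible X T') (by rw [hlen.1, ← heq, dist_self, zero_add])
    omega
  · -- separated member: contradiction with connectedness
    have hcl : IsClosed (carrier T') := by
      have : carrier T' = ⋃ s ∈ {s | s ∈ T'}, segment ℝ s.1 s.2 := by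
        ext z; simp [mem_carrier]
      rw [this]
      exact (List.finite_toSet T').isClosed_biUnion fun s _ => isClosed_segment' s
    obtain ⟨s₀, hs₀⟩ := List.exists_mem_of_ne_nil T' hT'ne
    have hne' : (carrier T').Nonempty := ⟨s₀.1, mem_carrier.2 ⟨s₀, hs₀, left_mem_segment ℝ _ _⟩⟩
    have hcov : carrier T ⊆ {σ.1} ∪ carrier T' := by
      rw [carrier_eq_union_erase hσ, ← heq, segment_same]
    have hdisj : carrier T ∩ ({σ.1} ∩ carrier T') = ∅ := by
      ext z
      simp only [Set.mem_inter_iff, Set.mem_singleton_iff, Set.mem_empty_iff_false, iff_false, not_and]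
      rintro - rfl
      exact hp
    rcases (isPreconnected_iff_subset_of_disjoint_closed.1 h.adm.connected.isPreconnected) {σ.1} (carrier T')
      isClosed_singleton hcl hcov hdisj with hsub | hsub
    · have : s₀.1 ∈ ({σ.1} : Set (RPt d)) :=
        hsub (mem_carrier.2 ⟨s₀, List.erase_subset hs₀, left_mem_segment ℝ _ _⟩)
      rw [Set.mem_singleton_iff] at this
      exact hp (this ▸ mem_carrier.2 ⟨s₀, hs₀, left_mem_segment ℝ _ _⟩)
    · exact hp (hsub (mem_carrier.2 ⟨σ, hσ, left_mem_segment ℝ _ _⟩))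

/-! ## §4. Collinear members: two members with two common points merge into one segment -/

/-- Distances along a parametrised line scale: |γ_s(a) − γ_s(b)| = |a − b|·|s₁ − s₂|. [cite: Balaban1987RG1, p.257 (linear size d_j, a shortest graph)] -/
theorem dist_gam_gam_eq (s : Seg d) (a b : ℝ) : dist (gam s a) (gam s b) = |a - b| * dist s.1 s.2 := by
  have h : gam s a - gam s b = (a - b) • (s.2 - s.1) := by
    ext i
    simp only [gam_apply, Pi.sub_apply, Pi.smul_apply, smul_eq_mul]
    ring
  rw [dist_eq_norm, h, norm_smul, Real.norm_eq_abs, dist_eq_norm, norm_sub_rev]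

/-- Segments between two points of a parametrised line are images of parameter intervals. [cite: Balaban1987RG1, p.257 (linear size d_j, a shortest graph)] -/
theorem segment_gam_gam (s : Seg d) (a b : ℝ) : segment ℝ (gam s a) (gam s b) = gam s '' Set.uIcc a b := by
  rw [segment_eq_image', ← segment_eq_uIcc, segment_eq_image']
  ext p
  simp only [Set.mem_image, Set.mem_Icc]
  constructor
  · rintro ⟨t, ht, rfl⟩
    refine ⟨a + t • (b - a), ⟨t, ht, rfl⟩, ?_⟩
    ext i
    simp only [gam_apply, Pi.add_apply, Pi.smul_apply, Pi.sub_apply, smul_eq_mul]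
    ring
  · rintro ⟨θ, ⟨t, ht, rfl⟩, rfl⟩
    refine ⟨t, ht, ?_⟩
    ext i
    simp only [gam_apply, Pi.add_apply, Pi.smul_apply, Pi.sub_apply, smul_eq_mul]
    ring

/-- Reparametrisation: the line through γ_σ(s) and γ_σ(t) is the line of σ. [cite: Balaban1987RG1, p.257 (linear size d_j, a shortest graph)] -/
theorem gam_gam_gam (σ : Seg d) (s t u : ℝ) : gam (gam σ s, gam σ t) u = gam σ (s + u * (t - s)) := by
  ext i
  simp only [gam_apply]
  ring

/-- A SEGMENT CONTAINING TWO DISTINCT POINTS p ≠ q LIES ON THE LINE THROUGH THEM: its endpoints are γ_(p,q)(a) and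
γ_(p,q)(b) with 0, 1 ∈ [a, b] (unordered interval). [cite: Balaban1987RG1, p.257 (linear size d_j, a shortest graph)] -/
theorem exists_params_of_two_mem {σ : Seg d} {p q : RPt d} (hp : p ∈ segment ℝ σ.1 σ.2)
    (hq : q ∈ segment ℝ σ.1 σ.2) (hpq : p ≠ q) :
    ∃ a b : ℝ, σ.1 = gam (p, q) a ∧ σ.2 = gam (p, q) b ∧ (0 : ℝ) ∈ Set.uIcc a b ∧ (1 : ℝ) ∈ Set.uIcc a b := by
  rw [segment_eq_image_gam] at hp hq
  obtain ⟨s, ⟨hs0, hs1⟩, rfl⟩ := hp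
  obtain ⟨t, ⟨ht0, ht1⟩, rfl⟩ := hq
  have hst : s ≠ t := fun h => hpq (by rw [h])
  have h1 : σ.1 = gam (gam σ s, gam σ t) (-s / (t - s)) := by
    rw [gam_gam_gam, show s + -s / (t - s) * (t - s) = 0 by field_simp [sub_ne_zero.2 (Ne.symm hst)]; ring]
    simp [gam]
  have h2 : σ.2 = gam (gam σ s, gam σ t) ((1 - s) / (t - s)) := by
    rw [gam_gam_gam, show s + (1 - s) / (t - s) * (t - s) = 1 by field_simp [sub_ne_zero.2 (Ne.symm hst)]; ring]
    simp [gam]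
  refine ⟨-s / (t - s), (1 - s) / (t - s), h1, h2, ?_, ?_⟩
  · rcases lt_or_gt_of_ne hst with hlt | hlt
    · have hD : 0 < t - s := sub_pos.2 hlt
      rw [Set.mem_uIcc]
      refine Or.inl ⟨?_, ?_⟩
      · rw [div_le_iff₀ hD]; linarith
      · exact div_nonneg (by linarith) hD.le
    · have hD : t - s < 0 := sub_neg.2 hlt
      rw [Set.mem_uIcc]
      refine Or.inr ⟨?_, ?_⟩
      · rw [div_le_iff_of_neg hD]; linarith
      · rw [le_div_iff_of_neg hD]; linarith
  · rcases lt_or_gt_of_ne hst with hlt | hlt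
    · have hD : 0 < t - s := sub_pos.2 hlt
      rw [Set.mem_uIcc]
      refine Or.inl ⟨?_, ?_⟩
      · rw [div_le_iff₀ hD]; linarith
      · rw [le_div_iff₀ hD]; linarith
    · have hD : t - s < 0 := sub_neg.2 hlt
      rw [Set.mem_uIcc]
      refine Or.inr ⟨?_, ?_⟩
      · rw [div_le_iff_of_neg hD]; linarith
      · rw [le_div_iff_of_neg hD]; linarith

/-- Two unordered intervals containing 0 have as union the interval between the extreme endpoints. [cite: Balaban1987RG1, p.257 (linear size d_j, a shortest graph)] -/
theorem uIcc_union_uIcc_of_zero_mem {a b a' b' : ℝ} (h0 : (0 : ℝ) ∈ Set.uIcc a b) (h0' : (0 : ℝ) ∈ Set.uIcc a' b') :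
    Set.uIcc a b ∪ Set.uIcc a' b' = Set.Icc (min (min a b) (min a' b')) (max (max a b) (max a' b')) := by
  rw [Set.uIcc, Set.uIcc] at *
  ext x
  simp only [Set.mem_union, Set.mem_Icc] at *
  constructor
  · rintro (⟨h1, h2⟩ | ⟨h1, h2⟩)
    · exact ⟨(min_le_left _ _).trans h1, h2.trans (le_max_left _ _)⟩
    · exact ⟨(min_le_right _ _).trans h1, h2.trans (le_max_right _ _)⟩
  · rintro ⟨h1, h2⟩
    rcases le_total x 0 with hx | hx
    · rcases min_le_iff.1 h1 with h | h
      · exact Or.inl ⟨h, hx.trans h0.2⟩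
      · exact Or.inr ⟨h, hx.trans h0'.2⟩
    · rcases le_max_iff.1 h2 with h | h
      · exact Or.inl ⟨h0.1.trans hx, h⟩
      · exact Or.inr ⟨h0'.1.trans hx, h⟩

/-- MERGING TWO MEMBERS WITH TWO COMMON POINTS: if distinct members σ, τ of an admissible graph both contain the
points p ≠ q, then replacing them by the hull segment of σ ∪ τ on the line through p and q gives an admissible
graph with the same carrier, not longer, and with one member less. [cite: Balaban1987RG1, p.257 (linear size d_j, a shortest graph)] -/
theorem exists_merge {X : Finset (Pt d)} {T : List (Seg d)} (hT : Admissible X T) {σ τ : Seg d} (hσ : σ ∈ T)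
    (hτ : τ ∈ T) (hστ : σ ≠ τ) {p q : RPt d} (hpq : p ≠ q) (hpσ : p ∈ segment ℝ σ.1 σ.2)
    (hqσ : q ∈ segment ℝ σ.1 σ.2) (hpτ : p ∈ segment ℝ τ.1 τ.2) (hqτ : q ∈ segment ℝ τ.1 τ.2) :
    ∃ T', Admissible X T' ∧ len T' ≤ len T ∧ T'.length + 1 = T.length := by
  obtain ⟨a, b, ha, hb, h0, h1⟩ := exists_params_of_two_mem hpσ hqσ hpq
  obtain ⟨a', b', ha', hb', h0', h1'⟩ := exists_params_of_two_mem hpτ hqτ hpq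
  set L : Seg d := (p, q) with hL
  set m : ℝ := min (min a b) (min a' b') with hm
  set M : ℝ := max (max a b) (max a' b') with hM
  have hmM : m ≤ M := (min_le_left _ _).trans ((min_le_left _ _).trans ((le_max_left _ _).trans (le_max_left _ _)))
  set H : Seg d := (gam L m, gam L M) with hH
  -- segments as images
  have hsegσ : segment ℝ σ.1 σ.2 = gam L '' Set.uIcc a b := by rw [ha, hb, segment_gam_gam]
  have hsegτ : segment ℝ τ.1 τ.2 = gam L '' Set.uIcc a' b' := by rw [ha', hb', segment_gam_gam]
  have hsegH : segment ℝ H.1 H.2 = segment ℝ σ.1 σ.2 ∪ segment ℝ τ.1 τ.2 := by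
    rw [hsegσ, hsegτ, ← Set.image_union, uIcc_union_uIcc_of_zero_mem h0 h0', hH, segment_gam_gam,
      Set.uIcc_of_le hmM]
  -- the new graph
  have hτ' : τ ∈ T.erase σ := (List.mem_erase_of_ne (Ne.symm hστ)).2 hτ
  set T' : List (Seg d) := H :: (T.erase σ).erase τ with hT'
  have hcarr : carrier T' = carrier T := by
    rw [hT', carrier_cons, hsegH, carrier_eq_union_erase hσ, carrier_eq_union_erase hτ', Set.union_assoc]
  obtain ⟨hlenσ, hlσ⟩ := len_erase hσ
  obtain ⟨hlenτ, hlτ⟩ := len_erase hτ'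
  refine ⟨T', ⟨hcarr ▸ hT.connected, hcarr ▸ hT.subset, fun x hx => hcarr ▸ hT.meets x hx⟩, ?_, ?_⟩
  · rw [hT', len_cons, hlenσ, hlenτ, ← add_assoc]
    refine add_le_add ?_ le_rfl
    -- dist H ≤ dist σ + dist τ
    have hdH : dist H.1 H.2 = (M - m) * dist p q := by
      rw [hH, dist_gam_gam_eq, abs_of_nonpos (by linarith), neg_sub]
    have hdσ : dist σ.1 σ.2 = |a - b| * dist p q := by rw [ha, hb, dist_gam_gam_eq]
    have hdτ : dist τ.1 τ.2 = |a' - b'| * dist p q := by rw [ha', hb', dist_gam_gam_eq]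
    rw [hdH, hdσ, hdτ, ← add_mul]
    refine mul_le_mul_of_nonneg_right ?_ dist_nonneg
    rw [Set.mem_uIcc] at h0 h0'
    have e1 : |a - b| = max a b - min a b := by
      rcases le_total a b with h | h
      · rw [abs_of_nonpos (by linarith), max_eq_right h, min_eq_left h]; ring
      · rw [abs_of_nonneg (by linarith), max_eq_left h, min_eq_right h]
    have e2 : |a' - b'| = max a' b' - min a' b' := by
      rcases le_total a' b' with h | h
      · rw [abs_of_nonpos (by linarith), max_eq_right h, min_eq_left h]; ring
      · rw [abs_of_nonneg (by linarith), max_eq_left h, min_eq_right h]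
    rw [e1, e2, hM, hm]
    have hmin0 : min a b ≤ 0 := by rcases h0 with ⟨h, -⟩ | ⟨h, -⟩ <;> simp [h]
    have hmin0' : min a' b' ≤ 0 := by rcases h0' with ⟨h, -⟩ | ⟨h, -⟩ <;> simp [h]
    have hmax0 : 0 ≤ max a b := by rcases h0 with ⟨-, h⟩ | ⟨-, h⟩ <;> simp [h]
    have hmax0' : 0 ≤ max a' b' := by rcases h0' with ⟨-, h⟩ | ⟨-, h⟩ <;> simp [h]
    have k1 : max (max a b) (max a' b') ≤ max a b + max a' b' := max_le (by linarith) (by linarith)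
    have k2 : min a b + min a' b' ≤ min (min a b) (min a' b') := le_min (by linarith) (by linarith)
    linarith
  · rw [hT', List.length_cons]
    omega

/-! ## §5. SIMPLEST SHORTEST GRAPHS ARE SIMPLE: two distinct members meet in at most one point -/

/-- In a simplest shortest graph two DISTINCT members have AT MOST ONE COMMON POINT (otherwise they are collinear and
merge into one member: an admissible graph, not longer, with fewer members). [cite: Balaban1987RG1, p.257 (linear size d_j, a shortest graph)] -/
theorem MinShortest.subsingleton_inter {X : Finset (Pt d)} {T : List (Seg d)} (h : MinShortest X T) {σ τ : Seg d}
    (hσ : σ ∈ T) (hτ : τ ∈ T) (hστ : σ ≠ τ) : (segment ℝ σ.1 σ.2 ∩ segment ℝ τ.1 τ.2).Subsingleton := by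
  intro p hp q hq
  by_contra hpq
  obtain ⟨T', hT', hle, hlen⟩ := exists_merge h.adm hσ hτ hστ hpq hp.1 hq.1 hp.2 hq.2
  have := h.length_le hT' hle
  omega

/-- In particular a simplest shortest graph never lists a non-degenerate segment in BOTH orientations. [cite: Balaban1987RG1, p.257 (linear size d_j, a shortest graph)] -/
theorem MinShortest.swap_not_mem {X : Finset (Pt d)} {T : List (Seg d)} (h : MinShortest X T) {σ : Seg d}
    (hσ : σ ∈ T) (hne : σ.1 ≠ σ.2) : (σ.2, σ.1) ∉ T := by
  intro hτ
  have hστ : σ ≠ (σ.2, σ.1) := fun heq => hne (congrArg Prod.fst heq)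
  have hsub := h.subsingleton_inter hσ hτ hστ
  have h1 : σ.1 ∈ segment ℝ σ.1 σ.2 ∩ segment ℝ (σ.2, σ.1).1 (σ.2, σ.1).2 :=
    ⟨left_mem_segment ℝ _ _, right_mem_segment ℝ _ _⟩
  have h2 : σ.2 ∈ segment ℝ σ.1 σ.2 ∩ segment ℝ (σ.2, σ.1).1 (σ.2, σ.1).2 :=
    ⟨right_mem_segment ℝ _ _, left_mem_segment ℝ _ _⟩
  exact hne (hsub h1 h2)

/-- SUMMARY: a simplest shortest graph exists and is SIMPLE — either it is a single member, or all its members are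
non-degenerate segments, pairwise (as distinct members) meeting in at most one point. [cite: Balaban1987RG1, p.257 (linear size d_j, a shortest graph)] -/
theorem exists_simple_shortest_graph {X : Finset (Pt d)} (hne : ∃ T, Admissible X T) :
    ∃ T, Admissible X T ∧ len T = treeLen X ∧
      (T.length = 1 ∨ ((∀ σ ∈ T, σ.1 ≠ σ.2) ∧
        ∀ σ ∈ T, ∀ τ ∈ T, σ ≠ τ → (segment ℝ σ.1 σ.2 ∩ segment ℝ τ.1 τ.2).Subsingleton)) := by
  obtain ⟨T, h⟩ := exists_minShortest hne
  refine ⟨T, h.adm, h.len_eq, ?_⟩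
  by_cases h1 : T.length = 1
  · exact Or.inl h1
  · have hTne : T ≠ [] := by
      rintro rfl
      simpa using h.adm.connected.nonempty
    have h2 : 2 ≤ T.length := by
      have : 0 < T.length := List.length_pos_iff.2 hTne
      omega
    exact Or.inr ⟨fun σ hσ => h.nondegenerate h2 hσ, fun σ hσ τ hτ hστ => h.subsingleton_inter hσ hτ hστ⟩


/-! ## §6. Properly embedded polygonal graphs, their endpoint graph, tree graphs -/

/-- The ENDPOINTS of a polygonal graph. [cite: Balaban1987RG1, p.257 (linear size d_j, a shortest graph)] -/
def vertsR (T : List (Seg d)) : Finset (RPt d) := (T.map Prod.fst ++ T.map Prod.snd).toFinset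

/-- Membership in the endpoint set. [cite: Balaban1987RG1, p.257 (linear size d_j, a shortest graph)] -/
theorem mem_vertsR {T : List (Seg d)} {u : RPt d} : u ∈ vertsR T ↔ ∃ e ∈ T, u = e.1 ∨ u = e.2 := by
  unfold vertsR
  simp only [List.mem_toFinset, List.mem_append, List.mem_map]
  constructor
  · rintro (⟨e, he, he'⟩ | ⟨e, he, he'⟩)
    · exact ⟨e, he, Or.inl he'.symm⟩
    · exact ⟨e, he, Or.inr he'.symm⟩
  · rintro ⟨e, he, h | h⟩
    · exact Or.inl ⟨e, he, h.symm⟩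
    · exact Or.inr ⟨e, he, h.symm⟩

/-- PROPERLY EMBEDDED polygonal graphs: any two members either are the same segment (possibly with reversed
orientation) or have only common points that are endpoints of both — no crossings, no T-junctions, no overlaps.
[cite: Balaban1987RG1, p.257 (linear size d_j, a shortest graph)] -/
def ProperlyEmbedded (T : List (Seg d)) : Prop :=
  ∀ σ ∈ T, ∀ τ ∈ T, (σ = τ ∨ σ = (τ.2, τ.1)) ∨
    ∀ z ∈ segment ℝ σ.1 σ.2 ∩ segment ℝ τ.1 τ.2, (z = σ.1 ∨ z = σ.2) ∧ (z = τ.1 ∨ z = τ.2)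

/-- THE ENDPOINT GRAPH of a polygonal graph: vertices = endpoints, p ~ q iff p ≠ q and [p, q] or [q, p] is a member
(Mathlib `SimpleGraph.fromRel`). [cite: Balaban1987RG1, p.257 (linear size d_j, a shortest graph)] -/
def egraph (T : List (Seg d)) : SimpleGraph (vertsR T) :=
  SimpleGraph.fromRel fun a b => ((a : RPt d), (b : RPt d)) ∈ T

/-- A TREE GRAPH (p. 257 «tree graphs contained in X»): a properly embedded polygonal graph whose endpoint graph is a
tree. [cite: Balaban1987RG1, p.257 (linear size d_j, a shortest graph)] -/
def IsTreeGraph (T : List (Seg d)) : Prop := ProperlyEmbedded T ∧ (egraph T).IsTree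

/-- In a properly embedded graph two members whose segments meet have a common endpoint. [cite: Balaban1987RG1, p.257 (linear size d_j, a shortest graph)] -/
theorem exists_common_endpoint_of_properlyEmbedded {T : List (Seg d)} (hT : ProperlyEmbedded T) {e e' : Seg d}
    (he : e ∈ T) (he' : e' ∈ T) {z : RPt d} (hz : z ∈ segment ℝ e.1 e.2) (hz' : z ∈ segment ℝ e'.1 e'.2) :
    ∃ u, (u = e.1 ∨ u = e.2) ∧ (u = e'.1 ∨ u = e'.2) := by
  rcases hT e he e' he' with (rfl | rfl) | h
  · exact ⟨e.1, Or.inl rfl, Or.inl rfl⟩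
  · exact ⟨e'.2, Or.inl rfl, Or.inr rfl⟩
  · exact ⟨z, h z ⟨hz, hz'⟩⟩

/-- In a properly embedded graph an endpoint lying on a member segment is an endpoint of that member. [cite: Balaban1987RG1, p.257 (linear size d_j, a shortest graph)] -/
theorem endpoint_of_mem_segment_of_properlyEmbedded {T : List (Seg d)} (hT : ProperlyEmbedded T) {u : RPt d}
    (hu : u ∈ vertsR T) {e : Seg d} (he : e ∈ T) (hue : u ∈ segment ℝ e.1 e.2) : u = e.1 ∨ u = e.2 := by
  obtain ⟨e', he', hu'⟩ := mem_vertsR.1 hu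
  rcases hT e' he' e he with (rfl | rfl) | h
  · exact hu'
  · rcases hu' with h | h
    · exact Or.inr h
    · exact Or.inl h
  · have hz : u ∈ segment ℝ e'.1 e'.2 := by
      rcases hu' with rfl | rfl
      · exact left_mem_segment ℝ _ _
      · exact right_mem_segment ℝ _ _
    exact (h u ⟨hz, hue⟩).2

/-- An endpoint of a member lies on its segment. [cite: Balaban1987RG1, p.257 (linear size d_j, a shortest graph)] -/
theorem mem_segment_of_endpoint {u : RPt d} {e : Seg d} (h : u = e.1 ∨ u = e.2) : u ∈ segment ℝ e.1 e.2 := by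
  rcases h with rfl | rfl
  · exact left_mem_segment ℝ _ _
  · exact right_mem_segment ℝ _ _

/-- Every endpoint lies on the carrier. [cite: Balaban1987RG1, p.257 (linear size d_j, a shortest graph)] -/
theorem mem_carrier_of_mem_vertsR {T : List (Seg d)} {u : RPt d} (hu : u ∈ vertsR T) : u ∈ carrier T := by
  obtain ⟨e, he, h⟩ := mem_vertsR.1 hu
  exact mem_carrier.2 ⟨e, he, mem_segment_of_endpoint h⟩

/-- The two endpoints of a member are joined in the endpoint graph. [cite: Balaban1987RG1, p.257 (linear size d_j, a shortest graph)] -/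
theorem egraph_reachable_endpoints {T : List (Seg d)} {e : Seg d} (he : e ∈ T) :
    (egraph T).Reachable ⟨e.1, mem_vertsR.2 ⟨e, he, Or.inl rfl⟩⟩ ⟨e.2, mem_vertsR.2 ⟨e, he, Or.inr rfl⟩⟩ := by
  by_cases heq : e.1 = e.2
  · have : (⟨e.1, mem_vertsR.2 ⟨e, he, Or.inl rfl⟩⟩ : vertsR T) = ⟨e.2, mem_vertsR.2 ⟨e, he, Or.inr rfl⟩⟩ :=
      Subtype.ext heq
    rw [this]
  · refine SimpleGraph.Adj.reachable ?_
    rw [egraph, SimpleGraph.fromRel_adj]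
    refine ⟨fun h => heq (congrArg Subtype.val h), Or.inl ?_⟩
    simpa using he

/-- TOPOLOGICAL ⇒ COMBINATORIAL CONNECTEDNESS for properly embedded graphs: if the carrier is connected then so is
the endpoint graph (closed-set separation, as in `B12EdgeTreeLength257.cgraph_connected`). [cite: Balaban1987RG1, p.257 (linear size d_j, a shortest graph)] -/
theorem egraph_connected {T : List (Seg d)} (hc : IsConnected (carrier T)) (hT : ProperlyEmbedded T) :
    (egraph T).Connected := by
  classical
  have hTne : T ≠ [] := by
    rintro rfl
    simpa using hc.nonempty
  obtain ⟨e₀, he₀⟩ := List.exists_mem_of_ne_nil T hTne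
  haveI : Nonempty (vertsR T) := ⟨⟨e₀.1, mem_vertsR.2 ⟨e₀, he₀, Or.inl rfl⟩⟩⟩
  refine SimpleGraph.Connected.mk (fun a b => ?_)
  set C : Set (RPt d) := {u | ∃ h : u ∈ vertsR T, (egraph T).Reachable a ⟨u, h⟩} with hC
  have hkey : ∀ e ∈ T, (e.1 ∈ C ↔ e.2 ∈ C) := by
    intro e he
    have hr := egraph_reachable_endpoints he
    constructor
    · rintro ⟨h1, h⟩
      exact ⟨mem_vertsR.2 ⟨e, he, Or.inr rfl⟩, h.trans hr⟩
    · rintro ⟨h2, h⟩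
      exact ⟨mem_vertsR.2 ⟨e, he, Or.inl rfl⟩, h.trans hr.symm⟩
  have hend : ∀ e ∈ T, ∀ u, (u = e.1 ∨ u = e.2) → (u ∈ C ↔ e.1 ∈ C) := by
    rintro e he u (rfl | rfl)
    · rfl
    · exact (hkey e he).symm
  set A : Set (RPt d) := ⋃ e ∈ {e : Seg d | e ∈ T ∧ e.1 ∈ C}, segment ℝ e.1 e.2 with hA
  set B : Set (RPt d) := ⋃ e ∈ {e : Seg d | e ∈ T ∧ e.1 ∉ C}, segment ℝ e.1 e.2 with hB
  have hAc : IsClosed A :=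
    ((List.finite_toSet T).subset fun e he => he.1).isClosed_biUnion fun e _ => isClosed_segment' e
  have hBc : IsClosed B :=
    ((List.finite_toSet T).subset fun e he => he.1).isClosed_biUnion fun e _ => isClosed_segment' e
  have hcover : carrier T ⊆ A ∪ B := by
    intro p hp
    obtain ⟨e, he, hpe⟩ := mem_carrier.1 hp
    by_cases h1 : e.1 ∈ C
    · exact Or.inl (Set.mem_biUnion (show e ∈ {e : Seg d | e ∈ T ∧ e.1 ∈ C} from ⟨he, h1⟩) hpe)
    · exact Or.inr (Set.mem_biUnion (show e ∈ {e : Seg d | e ∈ T ∧ e.1 ∉ C} from ⟨he, h1⟩) hpe)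
  have hdisj : carrier T ∩ (A ∩ B) = ∅ := by
    ext p
    simp only [Set.mem_inter_iff, Set.mem_empty_iff_false, iff_false, not_and]
    intro _ hpA hpB
    rw [hA, Set.mem_iUnion₂] at hpA
    rw [hB, Set.mem_iUnion₂] at hpB
    obtain ⟨e, ⟨he, he1⟩, hpe⟩ := hpA
    obtain ⟨e', ⟨he', he'1⟩, hpe'⟩ := hpB
    obtain ⟨u, hu, hu'⟩ := exists_common_endpoint_of_properlyEmbedded hT he he' hpe hpe'
    exact he'1 ((hend e' he' u hu').1 ((hend e he u hu).2 he1))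
  have hsep := (isPreconnected_iff_subset_of_disjoint_closed.1 hc.isPreconnected) A B hAc hBc hcover hdisj
  have haC : (a : RPt d) ∈ C := ⟨a.2, SimpleGraph.Reachable.refl _⟩
  rcases hsep with hsub | hsub
  · have hbA := hsub (mem_carrier_of_mem_vertsR b.2)
    rw [hA, Set.mem_iUnion₂] at hbA
    obtain ⟨e₁, ⟨he₁, he₁C⟩, hb₁⟩ := hbA
    have hb' := endpoint_of_mem_segment_of_properlyEmbedded hT b.2 he₁ hb₁
    obtain ⟨hb, hr⟩ := (hend e₁ he₁ b hb').2 he₁C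
    exact hr
  · exfalso
    have haB := hsub (mem_carrier_of_mem_vertsR a.2)
    rw [hB, Set.mem_iUnion₂] at haB
    obtain ⟨e₁, ⟨he₁, he₁C⟩, ha₁⟩ := haB
    have ha' := endpoint_of_mem_segment_of_properlyEmbedded hT a.2 he₁ ha₁
    exact he₁C ((hend e₁ he₁ a ha').1 haC)

/-- The endpoint graph has at most as many edges as the graph has non-degenerate members. [cite: Balaban1987RG1, p.257 (linear size d_j, a shortest graph)] -/
theorem card_edgeSet_egraph_le (T : List (Seg d)) :
    Nat.card (egraph T).edgeSet ≤ (T.filter fun e => e.1 ≠ e.2).length := by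
  classical
  set F : List (Seg d) := T.filter fun e => e.1 ≠ e.2 with hF
  have hFE : ∀ e ∈ F.toFinset, e ∈ T ∧ e.1 ≠ e.2 := fun e he => by
    rw [List.mem_toFinset, hF, List.mem_filter] at he
    exact ⟨he.1, by simpa using he.2⟩
  let ψ : ↥F.toFinset → (egraph T).edgeSet := fun e =>
    ⟨s(⟨e.1.1, mem_vertsR.2 ⟨e.1, (hFE e.1 e.2).1, Or.inl rfl⟩⟩,
      ⟨e.1.2, mem_vertsR.2 ⟨e.1, (hFE e.1 e.2).1, Or.inr rfl⟩⟩), by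
      rw [SimpleGraph.mem_edgeSet, egraph, SimpleGraph.fromRel_adj]
      refine ⟨fun h => (hFE e.1 e.2).2 (congrArg Subtype.val h), Or.inl ?_⟩
      simpa using (hFE e.1 e.2).1⟩
  have hsurj : Function.Surjective ψ := by
    rintro ⟨z, hz⟩
    induction z using Sym2.ind with
    | h x y =>
      rw [SimpleGraph.mem_edgeSet, egraph, SimpleGraph.fromRel_adj] at hz
      obtain ⟨hne, hxy | hyx⟩ := hz
      · have hmem : ((x : RPt d), (y : RPt d)) ∈ F.toFinset := by
          rw [List.mem_toFinset, hF, List.mem_filter]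
          exact ⟨hxy, by simpa using fun h => hne (Subtype.ext h)⟩
        exact ⟨⟨_, hmem⟩, rfl⟩
      · have hmem : ((y : RPt d), (x : RPt d)) ∈ F.toFinset := by
          rw [List.mem_toFinset, hF, List.mem_filter]
          exact ⟨hyx, by simpa using fun h => hne (Subtype.ext h).symm⟩
        refine ⟨⟨_, hmem⟩, ?_⟩
        exact Subtype.ext Sym2.eq_swap
  calc Nat.card (egraph T).edgeSet ≤ Nat.card ↥F.toFinset := Nat.card_le_card_of_surjective ψ hsurj
    _ = F.toFinset.card := by rw [Nat.card_eq_fintype_card, Fintype.card_coe]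
    _ ≤ F.length := List.toFinset_card_le F

/-- A SINGLE MEMBER IS A TREE GRAPH. [cite: Balaban1987RG1, p.257 (linear size d_j, a shortest graph)] -/
theorem isTreeGraph_singleton {σ : Seg d} : IsTreeGraph [σ] := by
  classical
  have hpe : ProperlyEmbedded [σ] := by
    intro a ha b hb
    rw [List.mem_singleton] at ha hb
    subst ha; subst hb
    exact Or.inl (Or.inl rfl)
  refine ⟨hpe, ?_⟩
  have hconn : IsConnected (carrier [σ]) := by
    rw [carrier_cons, carrier_nil, Set.union_empty]
    exact (convex_segment _ _).isConnected ⟨_, left_mem_segment ℝ _ _⟩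
  rw [SimpleGraph.isTree_iff_connected_and_card]
  refine ⟨egraph_connected hconn hpe, ?_⟩
  have h1 := card_edgeSet_egraph_le [σ]
  have h2 := (egraph_connected hconn hpe).card_vert_le_card_edgeSet_add_one
  have hV : Nat.card (vertsR [σ]) = (vertsR [σ]).card := by rw [Nat.card_eq_fintype_card, Fintype.card_coe]
  rw [hV] at h2 ⊢
  by_cases heq : σ.1 = σ.2
  · have hv : vertsR [σ] = {σ.1} := by
      ext u; rw [mem_vertsR]; simp [heq]
    have hf : ([σ].filter fun e => e.1 ≠ e.2).length = 0 := by simp [heq]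
    have hc : (vertsR [σ]).card = 1 := by rw [hv, Finset.card_singleton]
    omega
  · have hv : vertsR [σ] = {σ.1, σ.2} := by
      ext u; rw [mem_vertsR]; simp
    have hf : ([σ].filter fun e => e.1 ≠ e.2).length = 1 := by simp [heq]
    have hc : (vertsR [σ]).card = 2 := by rw [hv, Finset.card_pair heq]
    omega

/-! ## §7. Spanning-tree extraction from a properly embedded admissible graph with a vertex in every cube -/

/-- Sum over the distinct members is at most the sum over the list (non-negative summands). [cite: Balaban1987RG1, p.257 (linear size d_j, a shortest graph)] -/
theorem sum_toFinset_dist_le_len : ∀ T : List (Seg d), ∑ e ∈ T.toFinset, dist e.1 e.2 ≤ len T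
  | [] => by simp
  | σ :: T => by
      classical
      rw [List.toFinset_cons, len_cons]
      by_cases h : σ ∈ T.toFinset
      · rw [Finset.insert_eq_of_mem h]
        exact (sum_toFinset_dist_le_len T).trans (le_add_of_nonneg_left dist_nonneg)
      · rw [Finset.sum_insert h]
        exact add_le_add le_rfl (sum_toFinset_dist_le_len T)

/-- SPANNING-TREE EXTRACTION: a properly embedded admissible graph with non-degenerate members and a vertex in every
cube of X contains an admissible TREE GRAPH, not longer. [cite: Balaban1987RG1, p.257 (linear size d_j, a shortest graph)] -/
theorem exists_treeGraph_sub {X : Finset (Pt d)} {T : List (Seg d)} (hT : Admissible X T) (hpe : ProperlyEmbedded T)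
    (hnd : ∀ e ∈ T, e.1 ≠ e.2) (hvx : ∀ x ∈ X, ∃ v ∈ vertsR T, v ∈ cube x) :
    ∃ T', (∀ e ∈ T', e ∈ T) ∧ Admissible X T' ∧ IsTreeGraph T' ∧ len T' ≤ len T := by
  classical
  obtain ⟨G, hle, hG⟩ := (egraph_connected hT.connected hpe).exists_isTree_le
  -- realise tree edges by members
  have hreal : ∀ t ∈ G.edgeFinset, ∃ e ∈ T, Sym2.map Subtype.val t = s(e.1, e.2) := by
    intro t ht
    rw [SimpleGraph.mem_edgeFinset] at ht
    induction t using Sym2.ind with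
    | h a b =>
      rw [SimpleGraph.mem_edgeSet] at ht
      have hab : (egraph T).Adj a b := hle ht
      rw [egraph, SimpleGraph.fromRel_adj] at hab
      obtain ⟨-, h | h⟩ := hab
      · exact ⟨_, h, by rw [Sym2.map_mk]⟩
      · exact ⟨_, h, by rw [Sym2.map_mk, Sym2.eq_swap]⟩
  choose f hfmem hfmap using hreal
  set T' : List (Seg d) := G.edgeFinset.attach.toList.map fun t => f t.1 t.2 with hT'
  have hmemT' : ∀ {e}, e ∈ T' ↔ ∃ (t : Sym2 (vertsR T)) (ht : t ∈ G.edgeFinset), e = f t ht := by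
    intro e
    rw [hT', List.mem_map]
    constructor
    · rintro ⟨⟨t, ht⟩, -, rfl⟩
      exact ⟨t, ht, rfl⟩
    · rintro ⟨t, ht, rfl⟩
      exact ⟨⟨t, ht⟩, Finset.mem_toList.2 (Finset.mem_attach _ _), rfl⟩
  have hsubT : ∀ e ∈ T', e ∈ T := by
    intro e he
    obtain ⟨t, ht, rfl⟩ := hmemT'.1 he
    exact hfmem t ht
  -- at least two vertices; every vertex has a G-neighbour
  have hTne : T ≠ [] := by
    rintro rfl
    simpa using hT.connected.nonempty
  obtain ⟨e₀, he₀⟩ := List.exists_mem_of_ne_nil T hTne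
  have hnb : ∀ v : vertsR T, ∃ w, G.Adj v w := by
    intro v
    -- a vertex different from v
    have hex : ∃ w : vertsR T, w ≠ v := by
      by_cases h : (e₀.1 : RPt d) = v
      · refine ⟨⟨e₀.2, mem_vertsR.2 ⟨e₀, he₀, Or.inr rfl⟩⟩, fun heq => hnd e₀ he₀ ?_⟩
        rw [h, ← heq]
      · exact ⟨⟨e₀.1, mem_vertsR.2 ⟨e₀, he₀, Or.inl rfl⟩⟩, fun heq => h (congrArg Subtype.val heq)⟩
    obtain ⟨w, hw⟩ := hex
    obtain ⟨p⟩ := hG.connected.preconnected v w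
    cases p with
    | nil => exact absurd rfl hw
    | cons hadj _ => exact ⟨_, hadj⟩
  -- a G-adjacency is realised by a member of T' containing both endpoints
  have hadjE : ∀ {p q : vertsR T}, G.Adj p q → ∃ m ∈ T',
      ((p : RPt d) = m.1 ∨ (p : RPt d) = m.2) ∧ ((q : RPt d) = m.1 ∨ (q : RPt d) = m.2) := by
    intro p q hpq
    have ht : s(p, q) ∈ G.edgeFinset := SimpleGraph.mem_edgeFinset.2 hpq
    refine ⟨f _ ht, hmemT'.2 ⟨_, ht, rfl⟩, ?_⟩
    have h := hfmap _ ht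
    rw [Sym2.map_mk, Sym2.eq_iff] at h
    rcases h with ⟨h1, h2⟩ | ⟨h1, h2⟩
    · exact ⟨Or.inl h1, Or.inr h2⟩
    · exact ⟨Or.inr h1, Or.inl h2⟩
  -- every vertex of T is an endpoint of a member of T'
  have hvert : ∀ v : vertsR T, ∃ m ∈ T', (v : RPt d) = m.1 ∨ (v : RPt d) = m.2 := by
    intro v
    obtain ⟨w, hw⟩ := hnb v
    obtain ⟨m, hm, hv, -⟩ := hadjE hw
    exact ⟨m, hm, hv⟩
  have hverts : vertsR T' = vertsR T := by
    ext v
    rw [mem_vertsR, mem_vertsR]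
    constructor
    · rintro ⟨e, he, h⟩
      exact ⟨e, hsubT e he, h⟩
    · rintro ⟨e, he, h⟩
      obtain ⟨m, hm, hv⟩ := hvert ⟨v, mem_vertsR.2 ⟨e, he, h⟩⟩
      exact ⟨m, hm, hv⟩
  -- connectedness of the carrier of T'
  obtain ⟨m₀, hm₀, -⟩ := hvert ⟨e₀.1, mem_vertsR.2 ⟨e₀, he₀, Or.inl rfl⟩⟩
  haveI : Nonempty {e // e ∈ T'} := ⟨⟨m₀, hm₀⟩⟩
  have link : ∀ {u v : vertsR T} (w : G.Walk u v) (i : {e // e ∈ T'}),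
      ((u : RPt d) = i.1.1 ∨ (u : RPt d) = i.1.2) → ∃ j : {e // e ∈ T'}, ((v : RPt d) = j.1.1 ∨ (v : RPt d) = j.1.2) ∧
        ReflTransGen (fun i j : {e // e ∈ T'} =>
          (segment ℝ i.1.1 i.1.2 ∩ segment ℝ j.1.1 j.1.2).Nonempty) i j := by
    intro u v w
    induction w with
    | nil => exact fun i hi => ⟨i, hi, ReflTransGen.refl⟩
    | @cons a b c hab w ih =>
        intro i hi
        obtain ⟨m, hm, ha, hb⟩ := hadjE hab
        obtain ⟨j, hj, hmj⟩ := ih ⟨m, hm⟩ hb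
        refine ⟨j, hj, ReflTransGen.head ?_ hmj⟩
        exact ⟨(a : RPt d), mem_segment_of_endpoint hi, mem_segment_of_endpoint ha⟩
  have hconn : IsConnected (carrier T') := by
    have hU : (⋃ i : {e // e ∈ T'}, segment ℝ i.1.1 i.1.2) = carrier T' := by
      ext z
      rw [Set.mem_iUnion, mem_carrier]
      constructor
      · rintro ⟨⟨e, he⟩, hz⟩
        exact ⟨e, he, hz⟩
      · rintro ⟨e, he, hz⟩
        exact ⟨⟨e, he⟩, hz⟩
    rw [← hU]
    refine IsConnected.iUnion_of_reflTransGen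
      (fun i => (convex_segment _ _).isConnected ⟨_, left_mem_segment ℝ _ _⟩) fun i j => ?_
    have hi1 : i.1.1 ∈ vertsR T := mem_vertsR.2 ⟨i.1, hsubT _ i.2, Or.inl rfl⟩
    have hj1 : j.1.1 ∈ vertsR T := mem_vertsR.2 ⟨j.1, hsubT _ j.2, Or.inl rfl⟩
    obtain ⟨w⟩ := hG.connected.preconnected ⟨i.1.1, hi1⟩ ⟨j.1.1, hj1⟩
    obtain ⟨j', hj', hij'⟩ := link w i (Or.inl rfl)
    exact hij'.tail ⟨j.1.1, mem_segment_of_endpoint hj', left_mem_segment ℝ _ _⟩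
  have hadm : Admissible X T' := by
    refine ⟨hconn, ?_, ?_⟩
    · intro z hz
      obtain ⟨e, he, hz⟩ := mem_carrier.1 hz
      exact hT.subset (mem_carrier.2 ⟨e, hsubT e he, hz⟩)
    · intro x hx
      obtain ⟨v, hv, hvx'⟩ := hvx x hx
      obtain ⟨m, hm, hvm⟩ := hvert ⟨v, hv⟩
      exact ⟨v, mem_carrier.2 ⟨m, hm, mem_segment_of_endpoint hvm⟩, hvx'⟩
  have hpe' : ProperlyEmbedded T' := fun a ha b hb => hpe a (hsubT a ha) b (hsubT b hb)
  -- counting: T' has |E(G)| members, all non-degenerate, and |V| = |E(G)| + 1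
  have hlenT' : T'.length = G.edgeFinset.card := by
    rw [hT', List.length_map, Finset.length_toList, Finset.card_attach]
  have hcardG : G.edgeFinset.card + 1 = (vertsR T).card := by
    rw [hG.card_edgeFinset, Fintype.card_coe]
  have htree : (egraph T').IsTree := by
    rw [SimpleGraph.isTree_iff_connected_and_card]
    refine ⟨egraph_connected hconn hpe', ?_⟩
    have h1 := card_edgeSet_egraph_le T'
    have h1' : (T'.filter fun e => e.1 ≠ e.2).length ≤ T'.length := List.length_filter_le _ _
    have h2 := (egraph_connected hconn hpe').card_vert_le_card_edgeSet_add_one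
    have h3 : Nat.card (vertsR T') = (vertsR T).card := by
      rw [Nat.card_eq_fintype_card, Fintype.card_coe, hverts]
    omega
  -- length: distinct members of T' are distinct members of T; Σ over them ≤ len T
  have hinj : ∀ (t₁ : Sym2 (vertsR T)) (h₁ : t₁ ∈ G.edgeFinset) (t₂ : Sym2 (vertsR T)) (h₂ : t₂ ∈ G.edgeFinset),
      f t₁ h₁ = f t₂ h₂ → t₁ = t₂ := by
    intro t₁ h₁ t₂ h₂ heq
    have e1 := hfmap t₁ h₁
    have e2 := hfmap t₂ h₂
    rw [heq, ← e2] at e1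
    exact Sym2.map.injective Subtype.val_injective e1
  have hlen : len T' ≤ len T := by
    have hnodup : T'.Nodup := by
      rw [hT']
      refine (Finset.nodup_toList _).map_on ?_
      rintro ⟨t₁, h₁⟩ - ⟨t₂, h₂⟩ - heq
      exact Subtype.ext (hinj t₁ h₁ t₂ h₂ heq)
    calc len T' = ∑ e ∈ T'.toFinset, dist e.1 e.2 := by
          rw [len_eq_sum_map, ← List.sum_toFinset _ hnodup]
      _ ≤ ∑ e ∈ T.toFinset, dist e.1 e.2 :=
          Finset.sum_le_sum_of_subset_of_nonneg (fun e he => List.mem_toFinset.2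
            (hsubT e (List.mem_toFinset.1 he))) fun _ _ _ => dist_nonneg
      _ ≤ len T := sum_toFinset_dist_le_len T
  exact ⟨T', hsubT, hadm, ⟨hpe', htree⟩, hlen⟩


/-! ## §8. Subdivision of a simple graph at its anchors: a properly embedded admissible graph, not longer, with a
vertex in every cube -/

/-- The parametrisation of a non-degenerate segment is injective. [cite: Balaban1987RG1, p.257 (linear size d_j, a shortest graph)] -/
theorem gam_injective {σ : Seg d} (hne : σ.1 ≠ σ.2) : Function.Injective (gam σ) := by
  intro a b hab
  have h : (a - b) • (σ.2 - σ.1) = 0 := by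
    have : gam σ a - gam σ b = (a - b) • (σ.2 - σ.1) := by
      ext i
      simp only [gam_apply, Pi.sub_apply, Pi.smul_apply, smul_eq_mul]
      ring
    rw [← this, hab, sub_self]
  rcases smul_eq_zero.1 h with h | h
  · exact sub_eq_zero.1 h
  · exact absurd (sub_eq_zero.1 h).symm hne

/-- Members of the path along a mapped list are images of CONSECUTIVE list elements. [cite: Balaban1987RG1, p.257 (linear size d_j, a shortest graph)] -/
theorem mem_pathSegs_map {f : ℝ → RPt d} : ∀ {l : List ℝ} {s : Seg d}, s ∈ pathSegs (l.map f) →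
    ∃ a b : ℝ, ∃ l₁ l₂ : List ℝ, l = l₁ ++ a :: b :: l₂ ∧ s = (f a, f b)
  | [], s, h => by simp at h
  | [a], s, h => by simp at h
  | a :: b :: l, s, h => by
      rw [List.map_cons, List.map_cons, pathSegs_cons_cons, List.mem_cons] at h
      rcases h with rfl | h
      · exact ⟨a, b, [], l, rfl, rfl⟩
      · rw [← List.map_cons] at h
        obtain ⟨a', b', l₁, l₂, hl, rfl⟩ := mem_pathSegs_map h
        exact ⟨a', b', a :: l₁, l₂, by rw [hl]; rfl, rfl⟩

/-- Consecutive elements of a strictly sorted list: a < b and no list element lies strictly between. [cite: Balaban1987RG1, p.257 (linear size d_j, a shortest graph)] -/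
theorem consecutive_of_sorted {l l₁ l₂ : List ℝ} {a b : ℝ} (hP : l.Pairwise (· < ·)) (hl : l = l₁ ++ a :: b :: l₂) :
    a < b ∧ ∀ c ∈ l, c ≤ a ∨ b ≤ c := by
  subst hl
  rw [List.pairwise_append] at hP
  obtain ⟨-, h2, h3⟩ := hP
  have hab : a < b := List.rel_of_pairwise_cons h2 List.mem_cons_self
  refine ⟨hab, fun c hc => ?_⟩
  rcases List.mem_append.1 hc with hc | hc
  · exact Or.inl (h3 c hc a List.mem_cons_self).le
  · rcases List.mem_cons.1 hc with rfl | hc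
    · exact Or.inl le_rfl
    · rcases List.mem_cons.1 hc with rfl | hc
      · exact Or.inr le_rfl
      · exact Or.inr (List.rel_of_pairwise_cons (List.Pairwise.of_cons h2) hc).le

/-- Length of the path along increasing parameters ≤ 1 of a segment: at most (1 − t₀)·|σ|. [cite: Balaban1987RG1, p.257 (linear size d_j, a shortest graph)] -/
theorem len_pathSegs_map_gam_le (σ : Seg d) : ∀ {l : List ℝ} (hl : l ≠ []), l.Pairwise (· ≤ ·) →
    (∀ u ∈ l, u ≤ 1) → len (pathSegs (l.map (gam σ))) ≤ (1 - l.head hl) * dist σ.1 σ.2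
  | [], h, _, _ => (h rfl).elim
  | [t], _, _, h1 => by
      have := h1 t (List.mem_singleton_self t)
      simp only [List.map_cons, List.map_nil, pathSegs_singleton, len_nil, List.head_cons]
      nlinarith [@dist_nonneg _ _ σ.1 σ.2]
  | t :: t' :: l, _, hP, h1 => by
      rw [List.map_cons, List.map_cons, pathSegs_cons_cons, len_cons, ← List.map_cons]
      have htt' : t ≤ t' := List.rel_of_pairwise_cons hP List.mem_cons_self
      have ih := len_pathSegs_map_gam_le σ (List.cons_ne_nil t' l) (List.Pairwise.of_cons hP)
        (fun u hu => h1 u (List.mem_cons_of_mem _ hu))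
      simp only [List.head_cons] at ih ⊢
      have hd : dist (gam σ t, gam σ t').1 (gam σ t, gam σ t').2 = |t - t'| * dist σ.1 σ.2 := dist_gam_gam_eq σ t t'
      rw [hd, abs_of_nonpos (by linarith)]
      nlinarith [@dist_nonneg _ _ σ.1 σ.2]

/-- Every list element is an endpoint of a member of the path (lists with ≥ 2 elements). [cite: Balaban1987RG1, p.257 (linear size d_j, a shortest graph)] -/
theorem exists_endpoint_pathSegs_map {f : ℝ → RPt d} : ∀ {l : List ℝ}, 2 ≤ l.length → ∀ {u : ℝ}, u ∈ l →
    ∃ s ∈ pathSegs (l.map f), f u = s.1 ∨ f u = s.2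
  | [], h, _, _ => by simp at h
  | [a], h, _, _ => by simp at h
  | a :: b :: l, _, u, hu => by
      rw [List.map_cons, List.map_cons, pathSegs_cons_cons]
      rcases List.mem_cons.1 hu with rfl | hu
      · exact ⟨_, List.mem_cons_self, Or.inl rfl⟩
      · by_cases hl : l = []
        · subst hl
          rw [List.mem_singleton] at hu
          subst hu
          exact ⟨_, List.mem_cons_self, Or.inr rfl⟩
        · have h2 : 2 ≤ (b :: l).length := by
            rw [List.length_cons]
            have := List.length_pos_iff.2 hl
            omega
          obtain ⟨s, hs, h⟩ := exists_endpoint_pathSegs_map (f := f) h2 hu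
          rw [List.map_cons] at hs
          exact ⟨s, List.mem_cons_of_mem _ hs, h⟩

/-- Every list element lies on the path (lists with ≥ 2 elements). [cite: Balaban1987RG1, p.257 (linear size d_j, a shortest graph)] -/
theorem mem_carrier_pathSegs_map {f : ℝ → RPt d} {l : List ℝ} (hl : 2 ≤ l.length) {u : ℝ} (hu : u ∈ l) :
    f u ∈ carrier (pathSegs (l.map f)) := by
  obtain ⟨s, hs, h⟩ := exists_endpoint_pathSegs_map (f := f) hl hu
  exact mem_carrier.2 ⟨s, hs, mem_segment_of_endpoint h⟩

/-- The path along a list with ≥ 2 elements is connected. [cite: Balaban1987RG1, p.257 (linear size d_j, a shortest graph)] -/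
theorem isConnected_carrier_pathSegs_map {f : ℝ → RPt d} {l : List ℝ} (hl : 2 ≤ l.length) :
    IsConnected (carrier (pathSegs (l.map f))) := by
  have hne : l.map f ≠ [] := by
    intro h
    rw [List.map_eq_nil_iff] at h
    subst h
    simp at hl
  obtain ⟨hc, -⟩ := isConnected_insert_carrier_pathSegs (l.map f) hne
  have hlne : l ≠ [] := by rintro rfl; simp at hl
  have hhead : (l.map f).head hne ∈ carrier (pathSegs (l.map f)) := by
    rw [List.head_map]
    exact mem_carrier_pathSegs_map hl (List.head_mem hlne)
  rwa [Set.insert_eq_of_mem hhead] at hc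

open Classical in
/-- THE SUBDIVISION of the member σ at the finite point set P: the path along σ through the points of P on σ (in the
order of their parameters). [cite: Balaban1987RG1, p.257 (linear size d_j, a shortest graph)] -/
def subdiv (P : Finset (RPt d)) (σ : Seg d) : List (Seg d) :=
  pathSegs ((Finset.sort ((P.filter fun c => c ∈ segment ℝ σ.1 σ.2).image (paramOf σ))).map (gam σ))

open Classical in
/-- The sorted parameter list of the subdivision. [cite: Balaban1987RG1, p.257 (linear size d_j, a shortest graph)] -/
theorem subdiv_params (P : Finset (RPt d)) (σ : Seg d) :
    ∃ l : List ℝ, subdiv P σ = pathSegs (l.map (gam σ)) ∧ l.Pairwise (· < ·) ∧ (∀ u ∈ l, 0 ≤ u ∧ u ≤ 1) ∧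
      (∀ c ∈ P, c ∈ segment ℝ σ.1 σ.2 → ∃ u ∈ l, gam σ u = c) ∧
      (∀ u ∈ l, gam σ u ∈ P) ∧ (σ.1 ∈ P → σ.1 ≠ σ.2 → (0 : ℝ) ∈ l) ∧ (σ.2 ∈ P → σ.1 ≠ σ.2 → (1 : ℝ) ∈ l) := by
  set S : Finset ℝ := (P.filter fun c => c ∈ segment ℝ σ.1 σ.2).image (paramOf σ) with hS
  refine ⟨Finset.sort S, rfl, List.sortedLT_iff_pairwise.1 (Finset.sortedLT_sort _), ?_, ?_, ?_, ?_, ?_⟩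
  · intro u hu
    obtain ⟨c, -, rfl⟩ := Finset.mem_image.1 ((Finset.mem_sort _).1 hu)
    exact paramOf_mem_Icc σ c
  · intro c hc hcσ
    refine ⟨paramOf σ c, (Finset.mem_sort _).2 (Finset.mem_image.2 ⟨c, Finset.mem_filter.2 ⟨hc, hcσ⟩, rfl⟩),
      (paramOf_spec hcσ).2⟩
  · intro u hu
    obtain ⟨c, hc, rfl⟩ := Finset.mem_image.1 ((Finset.mem_sort _).1 hu)
    obtain ⟨hcP, hcσ⟩ := Finset.mem_filter.1 hc
    rw [(paramOf_spec hcσ).2]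
    exact hcP
  · intro h1 hne
    have hmem : paramOf σ σ.1 ∈ S :=
      Finset.mem_image.2 ⟨σ.1, Finset.mem_filter.2 ⟨h1, left_mem_segment ℝ _ _⟩, rfl⟩
    have h0 : paramOf σ σ.1 = 0 := by
      apply gam_injective hne
      rw [(paramOf_spec (left_mem_segment ℝ σ.1 σ.2)).2]
      simp [gam]
    rw [h0] at hmem
    exact (Finset.mem_sort _).2 hmem
  · intro h2 hne
    have hmem : paramOf σ σ.2 ∈ S :=
      Finset.mem_image.2 ⟨σ.2, Finset.mem_filter.2 ⟨h2, right_mem_segment ℝ _ _⟩, rfl⟩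
    have h1 : paramOf σ σ.2 = 1 := by
      apply gam_injective hne
      rw [(paramOf_spec (right_mem_segment ℝ σ.1 σ.2)).2]
      simp [gam]
    rw [h1] at hmem
    exact (Finset.mem_sort _).2 hmem

/-- The sub-segments lie on σ. [cite: Balaban1987RG1, p.257 (linear size d_j, a shortest graph)] -/
theorem segment_gam_subset {σ : Seg d} {a b : ℝ} (ha : 0 ≤ a ∧ a ≤ 1) (hb : 0 ≤ b ∧ b ≤ 1) :
    segment ℝ (gam σ a) (gam σ b) ⊆ segment ℝ σ.1 σ.2 :=
  (convex_segment _ _).segment_subset (gam_mem_segment_of_mem_Icc σ ⟨ha.1, ha.2⟩)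
    (gam_mem_segment_of_mem_Icc σ ⟨hb.1, hb.2⟩)

/-- THE POINT SET: endpoints and anchors. [cite: Balaban1987RG1, p.257 (linear size d_j, a shortest graph)] -/
def pts (X : Finset (Pt d)) (T : List (Seg d)) : Finset (RPt d) := vertsR T ∪ anchors X T

/-- THE SUBDIVIDED GRAPH. [cite: Balaban1987RG1, p.257 (linear size d_j, a shortest graph)] -/
def subdivAll (X : Finset (Pt d)) (T : List (Seg d)) : List (Seg d) := (T.map (subdiv (pts X T))).flatten

/-- Members of the subdivided graph. [cite: Balaban1987RG1, p.257 (linear size d_j, a shortest graph)] -/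
theorem mem_subdivAll {X : Finset (Pt d)} {T : List (Seg d)} {s : Seg d} :
    s ∈ subdivAll X T ↔ ∃ σ ∈ T, s ∈ subdiv (pts X T) σ := by
  rw [subdivAll, List.mem_flatten]
  constructor
  · rintro ⟨g, hg, hs⟩
    obtain ⟨σ, hσ, rfl⟩ := List.mem_map.1 hg
    exact ⟨σ, hσ, hs⟩
  · rintro ⟨σ, hσ, hs⟩
    exact ⟨_, List.mem_map.2 ⟨σ, hσ, rfl⟩, hs⟩

/-- The subdivided graph is not longer. [cite: Balaban1987RG1, p.257 (linear size d_j, a shortest graph)] -/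
theorem len_subdivAll_le (X : Finset (Pt d)) (T : List (Seg d)) : len (subdivAll X T) ≤ len T := by
  have key : ∀ σ : Seg d, σ ∈ T → len (subdiv (pts X T) σ) ≤ dist σ.1 σ.2 := by
    intro σ hσ
    obtain ⟨l, hl, hP, h01, hcov, -, -, -⟩ := subdiv_params (pts X T) σ
    have h1P : σ.1 ∈ pts X T := Finset.mem_union_left _ (mem_vertsR.2 ⟨σ, hσ, Or.inl rfl⟩)
    obtain ⟨u₀, hu₀, -⟩ := hcov σ.1 h1P (left_mem_segment ℝ _ _)
    have hne : l ≠ [] := List.ne_nil_of_mem hu₀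
    rw [hl]
    refine (len_pathSegs_map_gam_le σ hne (hP.imp le_of_lt) fun u hu => (h01 u hu).2).trans ?_
    exact mul_le_of_le_one_left dist_nonneg (by linarith [(h01 _ (List.head_mem hne)).1])
  suffices h : ∀ T' : List (Seg d), (∀ σ ∈ T', σ ∈ T) → len ((T'.map (subdiv (pts X T))).flatten) ≤ len T' from
    h T fun _ h => h
  intro T' hT'
  induction T' with
  | nil => simp
  | cons σ T' ih =>
      rw [List.map_cons, List.flatten_cons, len_append, len_cons]
      exact add_le_add (key σ (hT' σ List.mem_cons_self)) (ih fun τ hτ => hT' τ (List.mem_cons_of_mem _ hτ))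

/-- THE SUBDIVISION THEOREM: subdividing an admissible graph with non-degenerate members, two distinct members of
which meet in at most one point, at its endpoints and anchors yields a PROPERLY EMBEDDED admissible graph with
non-degenerate members, not longer, with a vertex in every cube of X. [cite: Balaban1987RG1, p.257 (linear size d_j, a shortest graph)] -/
theorem subdivAll_spec {X : Finset (Pt d)} {T : List (Seg d)} (hT : Admissible X T) (hnd : ∀ σ ∈ T, σ.1 ≠ σ.2)
    (hsimple : ∀ σ ∈ T, ∀ τ ∈ T, σ ≠ τ → (segment ℝ σ.1 σ.2 ∩ segment ℝ τ.1 τ.2).Subsingleton) :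
    Admissible X (subdivAll X T) ∧ ProperlyEmbedded (subdivAll X T) ∧ (∀ e ∈ subdivAll X T, e.1 ≠ e.2) ∧
      (∀ x ∈ X, ∃ v ∈ vertsR (subdivAll X T), v ∈ cube x) ∧ len (subdivAll X T) ≤ len T := by
  classical
  set P := pts X T with hPdef
  -- the parameter lists
  choose l hl hP h01 hcov hinP h0 h1 using fun σ => subdiv_params P σ
  have hends : ∀ σ ∈ T, σ.1 ∈ P ∧ σ.2 ∈ P := fun σ hσ =>
    ⟨Finset.mem_union_left _ (mem_vertsR.2 ⟨σ, hσ, Or.inl rfl⟩),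
      Finset.mem_union_left _ (mem_vertsR.2 ⟨σ, hσ, Or.inr rfl⟩)⟩
  have hlen2 : ∀ σ ∈ T, 2 ≤ (l σ).length := by
    intro σ hσ
    have hz : (0 : ℝ) ∈ l σ := h0 σ (hends σ hσ).1 (hnd σ hσ)
    have ho : (1 : ℝ) ∈ l σ := h1 σ (hends σ hσ).2 (hnd σ hσ)
    rcases hlist : l σ with _ | ⟨a, _ | ⟨b, l'⟩⟩
    · rw [hlist] at hz; simp at hz
    · rw [hlist] at hz ho
      simp only [List.mem_singleton] at hz ho
      linarith
    · simp
  -- anchors are points of P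
  have hanch : ∀ {c}, c ∈ anchors X T → c ∈ P := fun hc => Finset.mem_union_right _ hc
  have hmeetP : ∀ {σ τ}, σ ∈ T → τ ∈ T → meetPt σ τ ∈ P := by
    intro σ τ hσ hτ
    refine hanch ?_
    unfold anchors
    refine Finset.mem_union_left _ (Finset.mem_image.2 ⟨(σ, τ), ?_, rfl⟩)
    exact Finset.mem_product.2 ⟨List.mem_toFinset.2 hσ, List.mem_toFinset.2 hτ⟩
  -- members of the subdivided graph
  have hmem : ∀ {s : Seg d}, s ∈ subdivAll X T → ∃ σ ∈ T, ∃ a b : ℝ, ∃ l₁ l₂ : List ℝ,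
      l σ = l₁ ++ a :: b :: l₂ ∧ s = (gam σ a, gam σ b) := by
    intro s hs
    obtain ⟨σ, hσ, hs⟩ := mem_subdivAll.1 hs
    rw [hl σ] at hs
    obtain ⟨a, b, l₁, l₂, h, rfl⟩ := mem_pathSegs_map hs
    exact ⟨σ, hσ, a, b, l₁, l₂, h, rfl⟩
  -- list elements give vertices and points of the carrier
  have hvert : ∀ {σ}, σ ∈ T → ∀ {u}, u ∈ l σ → gam σ u ∈ vertsR (subdivAll X T) := by
    intro σ hσ u hu
    obtain ⟨s, hs, h⟩ := exists_endpoint_pathSegs_map (f := gam σ) (hlen2 σ hσ) hu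
    rw [← hl σ] at hs
    exact mem_vertsR.2 ⟨s, mem_subdivAll.2 ⟨σ, hσ, hs⟩, h⟩
  have hcarrσ : ∀ {σ}, σ ∈ T → ∀ {u}, u ∈ l σ → gam σ u ∈ carrier (subdiv P σ) := by
    intro σ hσ u hu
    rw [hl σ]
    exact mem_carrier_pathSegs_map (hlen2 σ hσ) hu
  -- a vertex in every cube
  have hvx : ∀ x ∈ X, ∃ v ∈ vertsR (subdivAll X T), v ∈ cube x := by
    intro x hx
    have hc := cubePt_mem (hT.meets x hx)
    obtain ⟨σ, hσ, hcσ⟩ := mem_carrier.1 hc.1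
    have hcP : cubePt T x ∈ P := by
      refine hanch ?_
      unfold anchors
      exact Finset.mem_union_right _ (Finset.mem_image_of_mem _ hx)
    obtain ⟨u, hu, hgu⟩ := hcov σ _ hcP hcσ
    exact ⟨_, hvert hσ hu, by rw [hgu]; exact hc.2⟩
  -- carrier of the subdivided graph
  have hcarr : ∀ {z}, z ∈ carrier (subdivAll X T) ↔ ∃ σ ∈ T, z ∈ carrier (subdiv P σ) := by
    intro z
    rw [subdivAll, mem_carrier_flatten]
    constructor
    · rintro ⟨g, hg, hz⟩
      obtain ⟨σ, hσ, rfl⟩ := List.mem_map.1 hg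
      exact ⟨σ, hσ, hz⟩
    · rintro ⟨σ, hσ, hz⟩
      exact ⟨_, List.mem_map.2 ⟨σ, hσ, rfl⟩, hz⟩
  -- admissibility
  have hsub : carrier (subdivAll X T) ⊆ carrier T := by
    intro z hz
    obtain ⟨s, hs, hzs⟩ := mem_carrier.1 hz
    obtain ⟨σ, hσ, a, b, l₁, l₂, hdec, rfl⟩ := hmem hs
    have ha : a ∈ l σ := by rw [hdec]; simp
    have hb : b ∈ l σ := by rw [hdec]; simp
    exact mem_carrier.2 ⟨σ, hσ, segment_gam_subset (h01 σ a ha) (h01 σ b hb) hzs⟩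
  have hconn : IsConnected (carrier (subdivAll X T)) := by
    have hTne : T ≠ [] := by
      rintro rfl
      simpa using hT.connected.nonempty
    obtain ⟨σ₀, hσ₀⟩ := List.exists_mem_of_ne_nil T hTne
    haveI : Nonempty {σ : Seg d // σ ∈ T} := ⟨⟨σ₀, hσ₀⟩⟩
    have hU : (⋃ i : {σ : Seg d // σ ∈ T}, segment ℝ i.1.1 i.1.2) = carrier T := by
      ext z
      simp only [Set.mem_iUnion, mem_carrier]
      constructor
      · rintro ⟨⟨σ, hσ⟩, hz⟩
        exact ⟨σ, hσ, hz⟩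
      · rintro ⟨σ, hσ, hz⟩
        exact ⟨⟨σ, hσ⟩, hz⟩
    have hK₀ := reflTransGen_of_isPreconnected_iUnion (s := fun i : {σ : Seg d // σ ∈ T} => segment ℝ i.1.1 i.1.2)
      (by rw [hU]; exact hT.connected.isPreconnected) (fun i => isClosed_segment' i.1)
      (fun i => ⟨_, left_mem_segment ℝ _ _⟩)
    have hU' : (⋃ i : {σ : Seg d // σ ∈ T}, carrier (subdiv P i.1)) = carrier (subdivAll X T) := by
      ext z
      rw [hcarr, Set.mem_iUnion]
      constructor
      · rintro ⟨⟨σ, hσ⟩, hz⟩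
        exact ⟨σ, hσ, hz⟩
      · rintro ⟨σ, hσ, hz⟩
        exact ⟨⟨σ, hσ⟩, hz⟩
    rw [← hU']
    refine IsConnected.iUnion_of_reflTransGen (fun i => ?_) fun i j => ?_
    · rw [hl i.1]
      exact isConnected_carrier_pathSegs_map (hlen2 i.1 i.2)
    · have h := hK₀ i j
      induction h with
      | refl => exact ReflTransGen.refl
      | @tail b c _ hbc ih =>
          refine ih.tail ?_
          have hm := meetPt_mem hbc
          obtain ⟨u, hu, hgu⟩ := hcov b.1 _ (hmeetP b.2 c.2) hm.1
          obtain ⟨u', hu', hgu'⟩ := hcov c.1 _ (hmeetP b.2 c.2) hm.2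
          refine ⟨meetPt b.1 c.1, ?_, ?_⟩
          · rw [← hgu]; exact hcarrσ b.2 hu
          · rw [← hgu']; exact hcarrσ c.2 hu'
  have hadm : Admissible X (subdivAll X T) := by
    refine ⟨hconn, hsub.trans hT.subset, fun x hx => ?_⟩
    obtain ⟨v, hv, hvx'⟩ := hvx x hx
    exact ⟨v, mem_carrier_of_mem_vertsR hv, hvx'⟩
  -- non-degenerate members
  have hnd₂ : ∀ e ∈ subdivAll X T, e.1 ≠ e.2 := by
    intro e he
    obtain ⟨σ, hσ, a, b, l₁, l₂, hdec, rfl⟩ := hmem he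
    have hab := (consecutive_of_sorted (hP σ) hdec).1
    intro h
    exact hab.ne (gam_injective (hnd σ hσ) h)
  -- proper embedding
  have hpe : ProperlyEmbedded (subdivAll X T) := by
    intro s hs s' hs'
    obtain ⟨σ, hσ, a, b, l₁, l₂, hdec, rfl⟩ := hmem hs
    obtain ⟨τ, hτ, a', b', l₁', l₂', hdec', rfl⟩ := hmem hs'
    obtain ⟨hab, hcons⟩ := consecutive_of_sorted (hP σ) hdec
    obtain ⟨hab', hcons'⟩ := consecutive_of_sorted (hP τ) hdec'
    have ha : a ∈ l σ := by rw [hdec]; simp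
    have hb : b ∈ l σ := by rw [hdec]; simp
    have ha' : a' ∈ l τ := by rw [hdec']; simp
    have hb' : b' ∈ l τ := by rw [hdec']; simp
    by_cases hc : σ = τ ∧ a = a'
    · obtain ⟨rfl, rfl⟩ := hc
      left; left
      have hbb' : b = b' := by
        rcases hcons b' hb' with h | h
        · exact absurd h (not_le.2 hab')
        · rcases hcons' b hb with h' | h'
          · exact absurd h' (not_le.2 hab)
          · exact le_antisymm h h'
      rw [hbb']
    · right
      rintro z ⟨hz, hz'⟩
      simp only at hz hz'
      rw [segment_gam_gam, Set.uIcc_of_le hab.le] at hz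
      rw [segment_gam_gam, Set.uIcc_of_le hab'.le] at hz'
      obtain ⟨u, ⟨hau, hub⟩, rfl⟩ := hz
      obtain ⟨u', ⟨hau', hub'⟩, hgu'⟩ := hz'
      by_cases hστ : σ = τ
      · subst hστ
        have haa' : a ≠ a' := fun h => hc ⟨rfl, h⟩
        have huu' : u' = u := gam_injective (hnd σ hσ) hgu'
        subst huu'
        rcases lt_or_gt_of_ne haa' with hlt | hlt
        · -- a < a' : then b ≤ a', so u = b = a'
          have hba' : b ≤ a' := by
            rcases hcons a' ha' with h | h
            · exact absurd h (not_le.2 hlt)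
            · exact h
          have hub' : u' = b := le_antisymm hub (hba'.trans hau')
          have hua : u' = a' := le_antisymm (hub.trans hba') hau'
          exact ⟨Or.inr (by rw [hub']), Or.inl (by rw [hua])⟩
        · have hba : b' ≤ a := by
            rcases hcons' a ha with h | h
            · exact absurd h (not_le.2 hlt)
            · exact h
          have hua : u' = a := le_antisymm (hub'.trans hba) hau
          have hub : u' = b' := le_antisymm hub' (hba.trans hau)
          exact ⟨Or.inl (by rw [hua]), Or.inr (by rw [hub])⟩
      · -- distinct members of T: their segments meet only at the anchor meetPt σ τ
        have hzσ : gam σ u ∈ segment ℝ σ.1 σ.2 := gam_mem_segment_of_mem_Icc σ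
          ⟨(h01 σ a ha).1.trans hau, hub.trans (h01 σ b hb).2⟩
        have hzτ : gam σ u ∈ segment ℝ τ.1 τ.2 := by
          rw [← hgu']
          exact gam_mem_segment_of_mem_Icc τ ⟨(h01 τ a' ha').1.trans hau', hub'.trans (h01 τ b' hb').2⟩
        have hm := meetPt_mem ⟨gam σ u, hzσ, hzτ⟩
        have hmz : meetPt σ τ = gam σ u := hsimple σ hσ τ hτ hστ hm ⟨hzσ, hzτ⟩
        constructor
        · obtain ⟨v, hv, hgv⟩ := hcov σ _ (hmeetP hσ hτ) hm.1
          have hvu : v = u := gam_injective (hnd σ hσ) (by rw [hgv, hmz])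
          subst hvu
          rcases hcons v hv with h | h
          · exact Or.inl (by rw [le_antisymm h hau])
          · exact Or.inr (by rw [le_antisymm hub h])
        · obtain ⟨v, hv, hgv⟩ := hcov τ _ (hmeetP hσ hτ) hm.2
          have hvu : v = u' := gam_injective (hnd τ hτ) (by rw [hgv, hmz, hgu'])
          subst hvu
          rcases hcons' v hv with h | h
          · exact Or.inl (by rw [← hgu', le_antisymm h hau'])
          · exact Or.inr (by rw [← hgu', le_antisymm hub' h])
  exact ⟨hadm, hpe, hnd₂, hvx, len_subdivAll_le X T⟩

/-! ## §9. MAIN: a shortest graph which is a TREE GRAPH -/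

/-- «CONSIDER A CLASS OF TREE GRAPHS CONTAINED IN X AND INTERSECTING ALL THE CUBES IN X. A LENGTH OF A SHORTEST
GRAPH IN THIS CLASS … IS THE LINEAR SIZE OF X»: the infimum `TreeLength.treeLen X` over connected finite unions of
segments (convention (ii) of `TreeLength`) is ATTAINED BY A TREE GRAPH — a properly embedded polygonal graph whose
endpoint graph is a tree — whenever X carries an admissible graph. [cite: Balaban1987RG1, p.257 (linear size d_j, a shortest graph)] -/
theorem exists_shortest_treeGraph {X : Finset (Pt d)} (hne : ∃ T, Admissible X T) :
    ∃ T, Admissible X T ∧ IsTreeGraph T ∧ len T = treeLen X := by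
  obtain ⟨T, h⟩ := exists_minShortest hne
  have hTne : T ≠ [] := by
    rintro rfl
    simpa using h.adm.connected.nonempty
  by_cases h1 : T.length = 1
  · obtain ⟨σ, hσ⟩ := List.length_eq_one_iff.1 h1
    subst hσ
    exact ⟨[σ], h.adm, isTreeGraph_singleton, h.len_eq⟩
  · have h2 : 2 ≤ T.length := by
      have := List.length_pos_iff.2 hTne
      omega
    obtain ⟨hT₂, hpe, hnd₂, hvx, hlen₂⟩ := subdivAll_spec h.adm (fun σ hσ => h.nondegenerate h2 hσ)
      (fun σ hσ τ hτ hστ => h.subsingleton_inter hσ hτ hστ)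
    obtain ⟨T₃, -, hT₃, htree, hlen₃⟩ := exists_treeGraph_sub hT₂ hpe hnd₂ hvx
    exact ⟨T₃, hT₃, htree, le_antisymm (hlen₃.trans (hlen₂.trans h.len_eq.le)) (treeLen_le_len hT₃)⟩

/-- CONVENTION (ii) OF `TreeLength` IS IMMATERIAL: the infimum of the lengths over admissible TREE GRAPHS equals
`treeLen X` (the infimum over all admissible graphs). [cite: Balaban1987RG1, p.257 (linear size d_j, a shortest graph)] -/
theorem treeLen_eq_sInf_treeGraphs {X : Finset (Pt d)} (hne : ∃ T, Admissible X T) :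
    treeLen X = sInf {ℓ | ∃ T, Admissible X T ∧ IsTreeGraph T ∧ len T = ℓ} := by
  obtain ⟨T₀, hT₀, htree₀, hlen₀⟩ := exists_shortest_treeGraph hne
  have hmem : treeLen X ∈ {ℓ | ∃ T, Admissible X T ∧ IsTreeGraph T ∧ len T = ℓ} := ⟨T₀, hT₀, htree₀, hlen₀⟩
  refine le_antisymm (le_csInf ⟨_, hmem⟩ ?_) (csInf_le ⟨0, ?_⟩ hmem)
  · rintro _ ⟨T, hT, -, rfl⟩
    exact treeLen_le_len hT
  · rintro _ ⟨T, -, -, rfl⟩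
    exact len_nonneg T

/-- For every LOCALIZATION DOMAIN a shortest tree graph exists. [cite: Balaban1987RG1, p.257 (linear size d_j, a shortest graph)] -/
theorem exists_shortest_treeGraph_of_faceConnected {Y : Finset (Pt d)} (hY : Y.Nonempty) (hc : FaceConnected Y) :
    ∃ T, Admissible Y T ∧ IsTreeGraph T ∧ len T = treeLen Y := by
  obtain ⟨T, hT, -⟩ := exists_admissible hY hc
  exact exists_shortest_treeGraph ⟨T, hT⟩


/-! ## §10 (revision v1.1, append-only; §§1–9 byte-identical to v1.0 = p321993, one `import`/`open` added:
`B12ShortestEdgeTree257`). THE PRINTED SENTENCES OF p. 257 WITH EVERY WORD LITERAL -/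

/-- ℓ¹ READING, EVERY WORD LITERAL — «there are also the shortest TREE graphs formed by EDGES of cubes in X»: an
admissible EDGE graph whose combinatorial graph is a TREE and whose ℓ¹ length is the ℓ¹ linear size `treeLen1 X`
(the infimum over ALL admissible polygonal graphs), i.e. not longer in ℓ¹ than any admissible graph, exists
(`B12ShortestEdgeTree257.exists_shortest_edgeTree` + `B12EdgeTreeLength257L1.treeLen1_eq_edgeLen`). [cite: Balaban1987RG1, p.257 (linear size d_j, edges of cubes)] -/
theorem exists_shortest_edgeTree_len1 {X : Finset (Pt d)} (hne : ∃ T, Admissible X T) :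
    ∃ E, EAdmissible X E ∧ (cgraph E).IsTree ∧ len1 (toSegs E) = treeLen1 X ∧
      ∀ T, Admissible X T → len1 (toSegs E) ≤ len1 T := by
  obtain ⟨T, hT⟩ := hne
  obtain ⟨E, hE, hn, -, ht⟩ := exists_shortest_edgeTree (exists_eAdmissible_of_admissible hT)
  have h1 : len1 (toSegs E) = treeLen1 X := by
    rw [len1_toSegs hE.lattice, hn, treeLen1_eq_edgeLen ⟨T, hT⟩]
  exact ⟨E, hE, ht, h1, fun T' hT' => h1 ▸ treeLen1_le_len1 hT'⟩

/-- SUP METRIC OF RECORD — BOTH KINDS OF SHORTEST TREE GRAPHS EXIST AND COMPARE WITHIN THE FACTOR d: a shortest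
(continuum) tree graph, of length treeLen X, and a shortest EDGE tree, of length edgeLen X, with
treeLen X ≤ edgeLen X ≤ d · treeLen X (`exists_shortest_treeGraph`, `exists_shortest_edgeTree`,
`B12EdgeTreeLength257.treeLen_le_edgeLen`, `B12EdgeTreeLength257L1.edgeLen_le_mul_treeLen`). [cite: Balaban1987RG1, p.257 (linear size d_j, edges of cubes)] -/
theorem shortest_trees_compare {X : Finset (Pt d)} (hne : ∃ T, Admissible X T) :
    ∃ T E, Admissible X T ∧ IsTreeGraph T ∧ len T = treeLen X ∧ EAdmissible X E ∧ (cgraph E).IsTree ∧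
      len (toSegs E) = (edgeLen X : ℝ) ∧ len T ≤ len (toSegs E) ∧ len (toSegs E) ≤ d * len T := by
  obtain ⟨T, hT, htree, hlen⟩ := exists_shortest_treeGraph hne
  have hneE : ∃ E, EAdmissible X E := let ⟨T₀, hT₀⟩ := hne; exists_eAdmissible_of_admissible hT₀
  obtain ⟨E, hE, hn, -, ht⟩ := exists_shortest_edgeTree hneE
  have hlenE : len (toSegs E) = (edgeLen X : ℝ) := by rw [len_toSegs hE.lattice, hn]
  refine ⟨T, E, hT, htree, hlen, hE, ht, hlenE, ?_, ?_⟩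
  · rw [hlen, hlenE]
    exact treeLen_le_edgeLen hneE
  · rw [hlen, hlenE]
    exact edgeLen_le_mul_treeLen hne


/-! ## §11 (revision v1.2, append-only; §§1–10 byte-identical to v1.1 = p322256). THE STEINER LENGTH: «the length of
a minimal TREE intersecting every cube in X» ([Dimock2013BalabanII] App. E, the wording behind `TreeLength.steinerLen`)
— `steinerLen Y` is attained by a TREE GRAPH -/

/-- Every point of ℝ^d lies in the unit cube of its integer part. [cite: Balaban1987RG1, p.257 (linear size d_j, a shortest graph)] -/
theorem mem_cube_floor (z : RPt d) : z ∈ cube (fun i => ⌊z i⌋) := by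
  rw [mem_cube]
  intro i
  exact ⟨Int.floor_le _, (Int.lt_floor_add_one _).le⟩

/-- THE CUBES MET BY A STEINER-ADMISSIBLE GRAPH form a finite set of unit cubes containing Y (the carrier is bounded:
`B12ShortestGraph257.carrier_subset_closedBall_of_sAdmissible`). [cite: Balaban1987RG1, p.257 (linear size d_j, a shortest graph)] -/
theorem exists_finset_cubes_meeting {Y : Finset (Pt d)} {T : List (Seg d)} (hT : SAdmissible Y T) (hY : Y.Nonempty) :
    ∃ X : Finset (Pt d), Y ⊆ X ∧ ∀ x, x ∈ X ↔ (carrier T ∩ cube x).Nonempty := by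
  classical
  obtain ⟨y₀, hy₀⟩ := hY
  have hball := carrier_subset_closedBall_of_sAdmissible hT hy₀ le_rfl
  set N : ℤ := (⌈len T + 1⌉₊ : ℤ) + 1 with hN
  set Box : Finset (Pt d) := Fintype.piFinset fun i => Finset.Icc (y₀ i - N) (y₀ i + N) with hBox
  have hkey : ∀ x : Pt d, (carrier T ∩ cube x).Nonempty → x ∈ Box := by
    rintro x ⟨z, hzT, hzx⟩
    rw [hBox, Fintype.mem_piFinset]
    intro i
    rw [Finset.mem_Icc]
    have hdz : dist z (corner y₀) ≤ len T + 1 := Metric.mem_closedBall.1 (hball hzT)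
    have hi : |z i - (y₀ i : ℝ)| ≤ len T + 1 := by
      have := dist_le_pi_dist z (corner y₀) i
      rw [Real.dist_eq] at this
      exact this.trans hdz
    obtain ⟨h1, h2⟩ := mem_cube.1 hzx i
    have hceil : len T + 1 ≤ (⌈len T + 1⌉₊ : ℝ) := Nat.le_ceil _
    rw [abs_le] at hi
    have hA : ((x i : ℤ) : ℝ) ≤ (y₀ i : ℝ) + (⌈len T + 1⌉₊ : ℝ) + 1 := by linarith
    have hB : (y₀ i : ℝ) - (⌈len T + 1⌉₊ : ℝ) - 1 ≤ ((x i : ℤ) : ℝ) := by linarith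
    constructor
    · have : ((y₀ i - N : ℤ) : ℝ) ≤ ((x i : ℤ) : ℝ) := by rw [hN]; push_cast; linarith
      exact_mod_cast this
    · have : ((x i : ℤ) : ℝ) ≤ ((y₀ i + N : ℤ) : ℝ) := by rw [hN]; push_cast; linarith
      exact_mod_cast this
  refine ⟨Box.filter fun x => (carrier T ∩ cube x).Nonempty, ?_, fun x => ?_⟩
  · intro y hy
    exact Finset.mem_filter.2 ⟨hkey y (hT.meets y hy), hT.meets y hy⟩
  · rw [Finset.mem_filter]
    exact ⟨fun h => h.2, fun h => ⟨hkey x h, h⟩⟩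

/-- A STEINER-ADMISSIBLE GRAPH IS ADMISSIBLE FOR THE SET OF CUBES IT MEETS. [cite: Balaban1987RG1, p.257 (linear size d_j, a shortest graph)] -/
theorem admissible_of_sAdmissible_cubes {Y X : Finset (Pt d)} {T : List (Seg d)} (hT : SAdmissible Y T)
    (hX : ∀ x, x ∈ X ↔ (carrier T ∩ cube x).Nonempty) : Admissible X T := by
  refine ⟨hT.connected, fun z hz => ?_, fun x hx => (hX x).1 hx⟩
  exact mem_cubes.2 ⟨_, (hX _).2 ⟨z, hz, mem_cube_floor z⟩, mem_cube_floor z⟩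

/-- «THE LENGTH OF A MINIMAL TREE INTERSECTING EVERY CUBE» — the Steiner length `TreeLength.steinerLen Y` of a
non-empty finite set of unit cubes is ATTAINED BY A TREE GRAPH (a Steiner-shortest graph T₀ exists by
`B12ShortestGraph257.exists_sAdmissible_len_eq_steinerLen`; for the finite set X ⊇ Y of cubes met by T₀ one has
treeLen X = steinerLen Y, and a shortest tree graph for X, §9, is Steiner-admissible for Y). [cite: Balaban1987RG1, p.257 (linear size d_j, a shortest graph)] -/
theorem exists_shortest_steiner_treeGraph {Y : Finset (Pt d)} (hY : Y.Nonempty) :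
    ∃ T, SAdmissible Y T ∧ IsTreeGraph T ∧ len T = steinerLen Y := by
  obtain ⟨T₀, hT₀, hlen₀⟩ := exists_sAdmissible_len_eq_steinerLen (exists_sAdmissible hY)
  obtain ⟨X, hYX, hX⟩ := exists_finset_cubes_meeting hT₀ hY
  have hadm : Admissible X T₀ := admissible_of_sAdmissible_cubes hT₀ hX
  have hSX : ∀ T, Admissible X T → SAdmissible Y T := fun T hT =>
    ⟨hT.connected, fun y hy => hT.meets y (hYX hy)⟩
  have htl : treeLen X = steinerLen Y := by
    refine le_antisymm (hlen₀ ▸ treeLen_le_len hadm) ?_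
    exact le_treeLen ⟨T₀, hadm⟩ fun T hT => steinerLen_le_len (hSX T hT)
  obtain ⟨T, hT, htree, hlen⟩ := exists_shortest_treeGraph ⟨T₀, hadm⟩
  exact ⟨T, hSX T hT, htree, by rw [hlen, htl]⟩

/-- The infimum of the lengths over Steiner-admissible TREE GRAPHS equals `steinerLen Y`. [cite: Balaban1987RG1, p.257 (linear size d_j, a shortest graph)] -/
theorem steinerLen_eq_sInf_treeGraphs {Y : Finset (Pt d)} (hY : Y.Nonempty) :
    steinerLen Y = sInf {ℓ | ∃ T, SAdmissible Y T ∧ IsTreeGraph T ∧ len T = ℓ} := by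
  obtain ⟨T₀, hT₀, htree₀, hlen₀⟩ := exists_shortest_steiner_treeGraph hY
  have hmem : steinerLen Y ∈ {ℓ | ∃ T, SAdmissible Y T ∧ IsTreeGraph T ∧ len T = ℓ} := ⟨T₀, hT₀, htree₀, hlen₀⟩
  refine le_antisymm (le_csInf ⟨_, hmem⟩ ?_) (csInf_le ⟨0, ?_⟩ hmem)
  · rintro _ ⟨T, hT, -, rfl⟩
    exact steinerLen_le_len hT
  · rintro _ ⟨T, -, -, rfl⟩
    exact len_nonneg T

end

end Literature.MathematicalPhysics.QuantumFieldTheory.Balaban1983to89.B12ShortestTreeGraph257
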